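import Literature.NumberTheory.GaloisRepresentations.ContinuousCharactersExtend
import Literature.NumberTheory.EllipticCurves.IwasawaEulerCharDualityProofs
import HarnessLib

/-!
# Pontryagin biduality for profinite abelian groups, surjectivity half: every character of the
# discrete dual `Hom_cont(G, ℚ/ℤ)` is evaluation at a point of `G`

Topic `NumberTheory/GaloisRepresentations` (companion of `ContinuousCharactersExtend` /
`ContinuousCharactersSeparatePoints`); namespace `Literature.NumberTheory.GaloisRepresentations`.  Theorems only (no definition, no named fact, no instance).

For a compact totally disconnected commutative topological group `G` the continuous characters
`χ : G → ℚ/ℤ` (the tree's continuous `1`-cocycles `contOneCocycles` of the trivial discrete module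
`QModZCoeff`, as in `ContinuousCharactersExtend` / `ContinuousCharactersSeparatePoints`) form a discrete
torsion group `X = Hom_cont(G, ℚ/ℤ)`; Pontryagin duality says `G ≅ Hom(X, ℚ/ℤ)`, `g ↦ (χ ↦ χ(g))`.  The
INJECTIVITY of this map is the tree's `exists_character_apply_ne_zero_of_ne_one` (characters separate
points); this file proves its SURJECTIVITY:

* §1 finite groups, `ℚ/ℤ`-valued characters (Mathlib's `CharacterModule A = A →+ ℚ/ℤ`):
  **`bijective_eval_characterModule`** (`A ≅ Hom(Hom(A, ℚ/ℤ), ℚ/ℤ)`, Serre, *Cours d'arithmétique* VI §1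
  Prop. 3, `ℚ/ℤ`-valued form; counting through the tree's `PontryaginCard.natCard_characterModule_of_finite`
  `|Hom(A, ℚ/ℤ)| = |A|` and separation by Mathlib's `CharacterModule.exists_character_apply_ne_zero_of_ne_zero`).
* §2 **`exists_forall_character_apply_eq`** — for `G` compact abelian (only compactness is used) and ANY additive
  `ψ : Hom_cont(G, ℚ/ℤ) → ℚ/ℤ` there is `g ∈ G` with `ψ(χ) = χ(g)` for every continuous character `χ`.
  Proof: the sets `K_χ = {g | χ(g) = ψ(χ)}` are closed; for finitely many `χ₁, …, χ_r` the open subgroup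
  `H = ⋂ ker χᵢ` has finite quotient `G/H`, the `χᵢ` are characters of `G/H`, `ψ` restricted to the (pulled
  back) characters of `G/H` is a character of `Hom(G/H, ℚ/ℤ)`, hence evaluation at some coset `gH` (§1), and
  `g ∈ ⋂ K_{χᵢ}`; compactness gives a point in all `K_χ`.

USE (Route A to Poitou–Tate over `(Γ_K, C̄)`, cell bsd-schneider-ideate, FINDING-door-c6-g11-allplaces (A5)):
the SURJECTIVITY of Milne's `α¹(Γ_F, ℤ/m) : C_F/m → H¹(Γ_F, ℤ/m)^* = Hom(Hom_cont(Γ_F^{ab}, ℤ/m), ℚ/ℤ)` is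
«`θ : C_F → Γ_F^{ab}` surjective» (tree, `IsGlobalReciprocityMap.surjective`) composed with this theorem for
the profinite abelian group `Γ_F^{ab}`; its injectivity is `GlobalReciprocityModPowers` (door-c6 g11).

## References
* J.-P. Serre, *A Course in Arithmetic* (1973), Chap. VI §1.1 Prop. 1–3 (finite biduality). [Serre1973]
* J.-P. Serre, *Local Fields* (1979), XIII §1 (characters of profinite abelian groups);
  E. Hewitt, K. A. Ross, *Abstract Harmonic Analysis* I (24.8) (Pontryagin duality). [SerreLocalFields1979]
-/

noncomputable section

open Function Topology

universe u

namespace Literature.NumberTheory.GaloisRepresentations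

open _root_.TopRep _root_.ContRepresentation _root_.ContinuousCohomology

/-! ## §1 Finite biduality with values in `ℚ/ℤ` -/

section Finite

/-- **Finite Pontryagin biduality, `ℚ/ℤ`-valued (Serre VI §1 Prop. 3): `a ↦ (c ↦ c(a))` is a bijection
`A → Hom(Hom(A, ℚ/ℤ), ℚ/ℤ)`** for a finite abelian group `A`: injective because characters separate points
(Mathlib `CharacterModule.exists_character_apply_ne_zero_of_ne_zero`, `ℚ/ℤ` divisible), bijective by counting
(`|A^∨∨| ≤ |A^∨| ≤ |A|`). [cite: Serre1973, Chap. VI §1.1 Prop. 3] -/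
theorem bijective_eval_characterModule (A : Type u) [AddCommGroup A] [Finite A] :
    Bijective (fun a : A =>
      (AddMonoidHom.mk' (fun c : CharacterModule A => c a) (fun _ _ => rfl) :
        CharacterModule (CharacterModule A))) := by
  haveI h1 : Finite (CharacterModule A) :=
    Literature.NumberTheory.EllipticCurves.PontryaginCard.finite_characterModule_of_finite A
  haveI h2 : Finite (CharacterModule (CharacterModule A)) :=
    Literature.NumberTheory.EllipticCurves.PontryaginCard.finite_characterModule_of_finite (CharacterModule A)
  haveI : Finite (CharacterModule A →+ AddCircle (1 : ℚ)) := h2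
  have hcard : Nat.card (CharacterModule (CharacterModule A)) = Nat.card A :=
    (Literature.NumberTheory.EllipticCurves.PontryaginCard.natCard_characterModule_of_finite
      (CharacterModule A)).trans
      (Literature.NumberTheory.EllipticCurves.PontryaginCard.natCard_characterModule_of_finite A)
  refine Injective.bijective_of_nat_card_le (fun a b hab => ?_) (le_of_eq hcard)
  by_contra hne
  obtain ⟨c, hc⟩ := CharacterModule.exists_character_apply_ne_zero_of_ne_zero (sub_ne_zero.2 hne)
  apply hc
  have h := DFunLike.congr_fun hab c
  change c a = c b at h
  rw [map_sub, h, sub_self]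

end Finite

/-! ## §2 Profinite abelian groups: every character of `Hom_cont(G, ℚ/ℤ)` is a point evaluation -/

section Profinite

variable {G : Type u} [CommGroup G] [TopologicalSpace G] [IsTopologicalGroup G] [CompactSpace G]

omit [IsTopologicalGroup G] [CompactSpace G] in
/-- For a continuous character `χ : G → ℚ/ℤ` (trivial action), `χ(gh) = χ(g) + χ(h)`. [folklore] -/
private theorem character_mul (χ : contOneCocycles (ContinuousRep.trivial G ℤ QModZCoeff.{u}).toTopRep)
    (g h : G) : χ.1 (g * h) = χ.1 g + χ.1 h :=
  χ.2 g h

omit [IsTopologicalGroup G] [CompactSpace G] in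
/-- For a continuous character `χ : G → ℚ/ℤ`, `χ(1) = 0`. [folklore] -/
private theorem character_one (χ : contOneCocycles (ContinuousRep.trivial G ℤ QModZCoeff.{u}).toTopRep) :
    χ.1 1 = 0 := by
  have h := character_mul χ 1 1
  rw [mul_one] at h
  exact left_eq_add.1 h

omit [IsTopologicalGroup G] [CompactSpace G] in
/-- For a continuous character `χ : G → ℚ/ℤ`, `χ(g⁻¹) = -χ(g)`. [folklore] -/
private theorem character_inv (χ : contOneCocycles (ContinuousRep.trivial G ℤ QModZCoeff.{u}).toTopRep)
    (g : G) : χ.1 g⁻¹ = -χ.1 g := by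
  have h := character_mul χ g g⁻¹
  rw [mul_inv_cancel, character_one] at h
  exact (neg_eq_of_add_eq_zero_right h.symm).symm

/-- **Pontryagin biduality for profinite abelian groups, surjectivity: every additive functional on the
continuous characters is evaluation at a point.**  For a compact totally disconnected commutative group `G`
and an additive map `ψ : Hom_cont(G, ℚ/ℤ) → ℚ/ℤ` there is `g ∈ G` with `ψ(χ) = χ(g)` for every continuous
character `χ : G → ℚ/ℤ` (only compactness is used; with `exists_character_apply_ne_zero_of_ne_one`, for `G`
profinite abelian: `G ≅ Hom(Hom_cont(G, ℚ/ℤ), ℚ/ℤ)`).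
Proof: each `K_χ = {g | χ(g) = ψ(χ)}` is closed; finitely many `χᵢ` factor through the finite quotient
`G/H`, `H = ⋂ ker χᵢ` open, where `ψ` is evaluation at a coset by finite biduality
(`bijective_eval_characterModule`); compactness. [cite: SerreLocalFields1979, XIII §1]
[cite: Serre1973, Chap. VI §1.1 Prop. 3] -/
theorem exists_forall_character_apply_eq
    (ψ : contOneCocycles (ContinuousRep.trivial G ℤ QModZCoeff.{u}).toTopRep →+ QModZCoeff.{u}) :
    ∃ g : G, ∀ χ : contOneCocycles (ContinuousRep.trivial G ℤ QModZCoeff.{u}).toTopRep, ψ χ = χ.1 g := by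
  classical
  -- the closed sets `K_χ`
  let K : contOneCocycles (ContinuousRep.trivial G ℤ QModZCoeff.{u}).toTopRep → Set G :=
    fun χ => {g | χ.1 g = ψ χ}
  have hK : ∀ χ, IsClosed (K χ) := fun χ =>
    isClosed_eq χ.1.continuous continuous_const
  suffices h : (⋂ χ, K χ).Nonempty by
    obtain ⟨g, hg⟩ := h
    exact ⟨g, fun χ => ((Set.mem_iInter.1 hg) χ).symm⟩
  refine CompactSpace.iInter_nonempty hK fun S => ?_
  -- the open subgroup `H = ⋂_{χ ∈ S} ker χ`
  let H : Subgroup G :=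
    { carrier := {g | ∀ χ ∈ S, χ.1 g = 0}
      mul_mem' := fun {a b} ha hb χ hχ => by rw [character_mul, ha χ hχ, hb χ hχ, add_zero]
      one_mem' := fun χ _ => character_one χ
      inv_mem' := fun {a} ha χ hχ => by rw [character_inv, ha χ hχ, neg_zero] }
  have hHopen : IsOpen (H : Set G) := by
    have h : (H : Set G) = ⋂ χ ∈ S, χ.1 ⁻¹' {0} := by
      ext g
      simp only [Set.mem_iInter, Set.mem_preimage, Set.mem_singleton_iff]
      rfl
    rw [h]
    exact isOpen_biInter_finset fun χ _ => (isOpen_discrete _).preimage χ.1.continuous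
  haveI hfin : Finite (G ⧸ H) := Subgroup.quotient_finite_of_isOpen H hHopen
  haveI : DiscreteTopology (G ⧸ H) := QuotientGroup.discreteTopology hHopen
  -- characters of the finite quotient, pulled back to `G`
  let A := Additive (G ⧸ H)
  let pull : CharacterModule A → contOneCocycles (ContinuousRep.trivial G ℤ QModZCoeff.{u}).toTopRep :=
    fun c => ⟨⟨fun x => ULift.up (c (Additive.ofMul (QuotientGroup.mk x : G ⧸ H))), by
      exact (continuous_of_discreteTopology (β := QModZCoeff.{u})
        (f := fun q : G ⧸ H => ULift.up (c (Additive.ofMul q)))).comp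
          (QuotientGroup.continuous_mk (N := H))⟩, fun a b => by
      change ULift.up (c (Additive.ofMul (QuotientGroup.mk (a * b) : G ⧸ H))) =
        ULift.up (c (Additive.ofMul (QuotientGroup.mk a : G ⧸ H))) +
          ULift.up (c (Additive.ofMul (QuotientGroup.mk b : G ⧸ H)))
      rw [QuotientGroup.mk_mul, ofMul_mul, map_add]
      rfl⟩
  have pull_apply : ∀ (c : CharacterModule A) (x : G),
      (pull c).1 x = ULift.up (c (Additive.ofMul (QuotientGroup.mk x : G ⧸ H))) := fun _ _ => rfl
  have pull_add : ∀ c c' : CharacterModule A, pull (c + c') = pull c + pull c' := fun c c' =>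
    Subtype.ext (ContinuousMap.ext fun x => rfl)
  -- `ψ` restricted to these characters, as a character of `Hom(G/H, ℚ/ℤ)`
  let Ψ : CharacterModule (CharacterModule A) :=
    { toFun := fun c => (ψ (pull c)).down
      map_zero' := by
        have h0 : pull 0 = 0 := Subtype.ext (ContinuousMap.ext fun x => rfl)
        rw [h0, map_zero]
        rfl
      map_add' := fun c c' => by
        rw [pull_add, map_add]
        rfl }
  -- finite biduality: `Ψ` is evaluation at a coset `a = gH`
  obtain ⟨a, ha⟩ := (bijective_eval_characterModule A).2 Ψ
  obtain ⟨g, hg⟩ := QuotientGroup.mk_surjective (Additive.toMul a)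
  refine ⟨g, Set.mem_iInter₂.2 fun χ hχ => ?_⟩
  -- `χ ∈ S` factors through `G/H`
  have hχH : ∀ x ∈ H, χ.1 x = 0 := fun x hx => hx χ hχ
  have hwd : ∀ x y : G, (QuotientGroup.mk x : G ⧸ H) = QuotientGroup.mk y → (χ.1 x).down = (χ.1 y).down := by
    intro x y hxy
    have hmem : x⁻¹ * y ∈ H := QuotientGroup.eq.1 hxy
    have h1 : χ.1 (x⁻¹ * y) = 0 := hχH _ hmem
    rw [character_mul, character_inv, neg_add_eq_zero] at h1
    rw [h1]
  let cχ : CharacterModule A :=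
    { toFun := fun q => (χ.1 (Quotient.out (Additive.toMul q))).down
      map_zero' := by
        have h := hwd (Quotient.out (Additive.toMul (0 : A))) 1 (by
          rw [QuotientGroup.out_eq']; rfl)
        rw [h, character_one]
        rfl
      map_add' := fun q q' => by
        have h := hwd (Quotient.out (Additive.toMul (q + q')))
          (Quotient.out (Additive.toMul q) * Quotient.out (Additive.toMul q')) (by
          rw [QuotientGroup.mk_mul, QuotientGroup.out_eq', QuotientGroup.out_eq', QuotientGroup.out_eq']
          rfl)
        rw [h, character_mul]
        rfl }
  have hcχ : ∀ x : G, cχ (Additive.ofMul (QuotientGroup.mk x : G ⧸ H)) = (χ.1 x).down := fun x =>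
    hwd _ _ (QuotientGroup.out_eq' _)
  have hpull : pull cχ = χ := Subtype.ext (ContinuousMap.ext fun x => by
    rw [pull_apply, hcχ]
    rfl)
  -- evaluate
  have h1 : (ψ χ).down = cχ a := by
    have := DFunLike.congr_fun ha cχ
    change cχ a = (ψ (pull cχ)).down at this
    rw [hpull] at this
    exact this.symm
  change χ.1 g = ψ χ
  apply ULift.ext
  rw [h1, ← hcχ g, hg, ofMul_toMul]

end Profinite

end Literature.NumberTheory.GaloisRepresentations

end
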